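import Summits.ResolutionOfSingularities.ResolutionOfSingularities.Theorems.ConeExit.Negative.Mirror

/-!
# `ConeExit` (crux stmt-ResolutionOfSingularities-16883, route `WildCones`): a certified `dL = 1`
# START state (negative-side support, refuter cdisprove seat; this file refutes nothing)

Data and kernel certificates, over the exact mirror `Negative/Mirror.lean` of the crux's calculus, for
the start of the CONVERSE witness (`Negative/ConverseFalse.lean`): `conv = u₁²u₂ + u₂⁵ + u₃⁷` over `𝔽₃`
(`n = 3`, `p = 3`) is `3`-clean, has multiplicity `3` (`multP_conv`) and cleaned order EXACTLY `3`
(`ordP_conv`), tangent cone `X₀²X₁` (`cone_conv`), cone-invariance space EXACTLY the line `⟨e₃⟩`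
(`mem_Linv_conv_iff`, by evaluating the defining identity of `Linv` at two points; `dL_conv : dL = 1`),
and is ISOLATED (`isol_conv`, certificate format `module_finite_quotient_of_X_pow_mem`). So `conv`
satisfies every hypothesis AND the conclusion of `ConeExit`; its forced successor is nevertheless not
isolated (`ConverseFalse.lean`).
-/

noncomputable section

-- single-problem summit: the doubled namespace component `ResolutionOfSingularities` is forced by the tree layout
set_option linter.dupNamespace false

namespace Summit.ResolutionOfSingularities.ResolutionOfSingularities.Theorems.ConeExit.Negative

open scoped BigOperators Classical
open MvPowerSeries

/-- The `d = 1` start `a = u₁²u₂ + u₂⁵ + u₃⁷` over `𝔽₃` (`n = 3`; cone `u₁²u₂`, `L = ⟨e₃⟩`), as a coefficient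
function. [folklore] -/
def conv : (Fin 3 → ℕ) → ZMod 3 :=
  fun A =>
    if A 0 = 0 ∧ A 1 = 0 ∧ A 2 = 7 then 1
    else if A 0 = 0 ∧ A 1 = 5 ∧ A 2 = 0 then 1
    else if A 0 = 2 ∧ A 1 = 1 ∧ A 2 = 0 then 1
    else 0


/-- Support of `conv`. [folklore] -/
lemma conv_ne_zero_iff (A : Fin 3 → ℕ) :
    conv A ≠ 0 ↔
      (A 0 = 0 ∧ A 1 = 0 ∧ A 2 = 7) ∨
      (A 0 = 0 ∧ A 1 = 5 ∧ A 2 = 0) ∨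
      (A 0 = 2 ∧ A 1 = 1 ∧ A 2 = 0) := by
  constructor
  · intro h
    unfold conv at h
    split_ifs at h with h1 h2 h3
    · exact Or.inl h1
    · exact Or.inr (Or.inl h2)
    · exact Or.inr (Or.inr (h3))
    · exact absurd rfl h
  · intro h
    unfold conv
    split_ifs <;> first | decide | (exfalso; omega)


/-- `conv` is `3`-clean. [folklore] -/
lemma clean_conv : clean 3 conv = conv := by
  funext A
  unfold clean
  split_ifs with h
  · symm
    by_contra hne
    rcases (conv_ne_zero_iff A).mp hne with hA | hA | hA
    · have := h 2; omega
    · have := h 1; omega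
    · have := h 0; omega
  · rfl


/-- `∂_0` of `conv` over `𝔽_3` (monomial form). [folklore] -/
lemma pd0_conv : pd 0 (ser 3 conv) = (monomial (Finsupp.single (0 : Fin 3) 1 + Finsupp.single (1 : Fin 3) 1) (2 : ZMod 3) : MvPowerSeries (Fin 3) (ZMod 3)) := by
  ext A
  rw [coeff_pd_ser, coeff_ser, clean_conv, coeff_monomial]
  have e0 : (A + Finsupp.single (0 : Fin 3) 1 : Fin 3 →₀ ℕ) 0 = A 0 + 1 := by simp
  have e1 : (A + Finsupp.single (0 : Fin 3) 1 : Fin 3 →₀ ℕ) 1 = A 1 := by simp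
  have e2 : (A + Finsupp.single (0 : Fin 3) 1 : Fin 3 →₀ ℕ) 2 = A 2 := by simp
  have hT0 : A = Finsupp.single (0 : Fin 3) 1 + Finsupp.single (1 : Fin 3) 1 ↔ A 0 = 1 ∧ A 1 = 1 ∧ A 2 = 0 := by
    constructor
    · intro h; subst h; simp
    · rintro ⟨h0, h1, h2⟩; ext j; fin_cases j <;> simp [h0, h1, h2]
  unfold conv
  simp only [e0, e1, e2]
  by_cases hc0 : A 0 = 1 ∧ A 1 = 1 ∧ A 2 = 0
  · rw [if_pos (hT0.mpr hc0),
      if_neg (show ¬ (A 0 + 1 = 0 ∧ A 1 = 0 ∧ A 2 = 7) by omega),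
      if_neg (show ¬ (A 0 + 1 = 0 ∧ A 1 = 5 ∧ A 2 = 0) by omega),
      if_pos (show A 0 + 1 = 2 ∧ A 1 = 1 ∧ A 2 = 0 by omega)]
    rw [show A 0 = 1 by omega]; decide
  · rw [if_neg (show ¬ (A = Finsupp.single (0 : Fin 3) 1 + Finsupp.single (1 : Fin 3) 1) from fun h' => by have := hT0.mp h'; omega),
      if_neg (show ¬ (A 0 + 1 = 0 ∧ A 1 = 0 ∧ A 2 = 7) by omega),
      if_neg (show ¬ (A 0 + 1 = 0 ∧ A 1 = 5 ∧ A 2 = 0) by omega),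
      if_neg (show ¬ (A 0 + 1 = 2 ∧ A 1 = 1 ∧ A 2 = 0) by omega),
      mul_zero]

/-- `∂_1` of `conv` over `𝔽_3` (monomial form). [folklore] -/
lemma pd1_conv : pd 1 (ser 3 conv) = (monomial (Finsupp.single (1 : Fin 3) 4) (2 : ZMod 3) + monomial (Finsupp.single (0 : Fin 3) 2) (1 : ZMod 3) : MvPowerSeries (Fin 3) (ZMod 3)) := by
  ext A
  rw [coeff_pd_ser, coeff_ser, clean_conv, map_add, coeff_monomial, coeff_monomial]
  have e0 : (A + Finsupp.single (1 : Fin 3) 1 : Fin 3 →₀ ℕ) 0 = A 0 := by simp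
  have e1 : (A + Finsupp.single (1 : Fin 3) 1 : Fin 3 →₀ ℕ) 1 = A 1 + 1 := by simp
  have e2 : (A + Finsupp.single (1 : Fin 3) 1 : Fin 3 →₀ ℕ) 2 = A 2 := by simp
  have hT0 : A = Finsupp.single (1 : Fin 3) 4 ↔ A 0 = 0 ∧ A 1 = 4 ∧ A 2 = 0 := by
    constructor
    · intro h; subst h; simp
    · rintro ⟨h0, h1, h2⟩; ext j; fin_cases j <;> simp [h0, h1, h2]
  have hT1 : A = Finsupp.single (0 : Fin 3) 2 ↔ A 0 = 2 ∧ A 1 = 0 ∧ A 2 = 0 := by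
    constructor
    · intro h; subst h; simp
    · rintro ⟨h0, h1, h2⟩; ext j; fin_cases j <;> simp [h0, h1, h2]
  unfold conv
  simp only [e0, e1, e2]
  by_cases hc0 : A 0 = 0 ∧ A 1 = 4 ∧ A 2 = 0
  · rw [if_pos (hT0.mpr hc0),
      if_neg (show ¬ (A = Finsupp.single (0 : Fin 3) 2) from fun h' => by have := hT1.mp h'; omega),
      if_neg (show ¬ (A 0 = 0 ∧ A 1 + 1 = 0 ∧ A 2 = 7) by omega),
      if_pos (show A 0 = 0 ∧ A 1 + 1 = 5 ∧ A 2 = 0 by omega)]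
    rw [show A 1 = 4 by omega]; decide
  · by_cases hc1 : A 0 = 2 ∧ A 1 = 0 ∧ A 2 = 0
    · rw [if_neg (show ¬ (A = Finsupp.single (1 : Fin 3) 4) from fun h' => by have := hT0.mp h'; omega),
        if_pos (hT1.mpr hc1),
        if_neg (show ¬ (A 0 = 0 ∧ A 1 + 1 = 0 ∧ A 2 = 7) by omega),
        if_neg (show ¬ (A 0 = 0 ∧ A 1 + 1 = 5 ∧ A 2 = 0) by omega),
        if_pos (show A 0 = 2 ∧ A 1 + 1 = 1 ∧ A 2 = 0 by omega)]
      rw [show A 1 = 0 by omega]; decide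
    · rw [if_neg (show ¬ (A = Finsupp.single (1 : Fin 3) 4) from fun h' => by have := hT0.mp h'; omega),
        if_neg (show ¬ (A = Finsupp.single (0 : Fin 3) 2) from fun h' => by have := hT1.mp h'; omega),
        if_neg (show ¬ (A 0 = 0 ∧ A 1 + 1 = 0 ∧ A 2 = 7) by omega),
        if_neg (show ¬ (A 0 = 0 ∧ A 1 + 1 = 5 ∧ A 2 = 0) by omega),
        if_neg (show ¬ (A 0 = 2 ∧ A 1 + 1 = 1 ∧ A 2 = 0) by omega),
        mul_zero,
        add_zero]

/-- `∂_2` of `conv` over `𝔽_3` (monomial form). [folklore] -/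
lemma pd2_conv : pd 2 (ser 3 conv) = (monomial (Finsupp.single (2 : Fin 3) 6) (1 : ZMod 3) : MvPowerSeries (Fin 3) (ZMod 3)) := by
  ext A
  rw [coeff_pd_ser, coeff_ser, clean_conv, coeff_monomial]
  have e0 : (A + Finsupp.single (2 : Fin 3) 1 : Fin 3 →₀ ℕ) 0 = A 0 := by simp
  have e1 : (A + Finsupp.single (2 : Fin 3) 1 : Fin 3 →₀ ℕ) 1 = A 1 := by simp
  have e2 : (A + Finsupp.single (2 : Fin 3) 1 : Fin 3 →₀ ℕ) 2 = A 2 + 1 := by simp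
  have hT0 : A = Finsupp.single (2 : Fin 3) 6 ↔ A 0 = 0 ∧ A 1 = 0 ∧ A 2 = 6 := by
    constructor
    · intro h; subst h; simp
    · rintro ⟨h0, h1, h2⟩; ext j; fin_cases j <;> simp [h0, h1, h2]
  unfold conv
  simp only [e0, e1, e2]
  by_cases hc0 : A 0 = 0 ∧ A 1 = 0 ∧ A 2 = 6
  · rw [if_pos (hT0.mpr hc0),
      if_pos (show A 0 = 0 ∧ A 1 = 0 ∧ A 2 + 1 = 7 by omega)]
    rw [show A 2 = 6 by omega]; decide
  · rw [if_neg (show ¬ (A = Finsupp.single (2 : Fin 3) 6) from fun h' => by have := hT0.mp h'; omega),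
      if_neg (show ¬ (A 0 = 0 ∧ A 1 = 0 ∧ A 2 + 1 = 7) by omega),
      if_neg (show ¬ (A 0 = 0 ∧ A 1 = 5 ∧ A 2 + 1 = 0) by omega),
      if_neg (show ¬ (A 0 = 2 ∧ A 1 = 1 ∧ A 2 + 1 = 0) by omega),
      mul_zero]

/-- The order of `conv` is at least `3` (it is `3`). [folklore] -/
lemma three_le_ord_conv : 3 ≤ ord conv := by
  unfold ord
  apply le_csInf
  · refine ⟨3, ![2, 1, 0], (conv_ne_zero_iff _).mpr ?_, ?_⟩
    · right; right; simp
    · simp [Fin.sum_univ_three]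
  · rintro m ⟨A, hA, rfl⟩
    rw [Fin.sum_univ_three]
    rcases (conv_ne_zero_iff A).mp hA with h | h | h <;> omega

/-- `conv` has multiplicity `3`. [folklore] -/
lemma multP_conv : (∃ A, clean 3 conv A ≠ 0) ∧
    ∀ A, clean 3 conv A ≠ 0 → 3 ≤ Finset.sum Finset.univ (fun j => A j) := by
  rw [clean_conv]
  refine ⟨⟨![2, 1, 0], (conv_ne_zero_iff _).mpr (by right; right; simp)⟩, ?_⟩
  intro A hA
  rw [Fin.sum_univ_three]
  rcases (conv_ne_zero_iff A).mp hA with h | h | h <;> omega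

/-- `conv` has cleaned order exactly `3`. [folklore] -/
lemma ordP_conv : ∃ A, clean 3 conv A ≠ 0 ∧ Finset.sum Finset.univ (fun j => A j) = 3 := by
  rw [clean_conv]
  exact ⟨![2, 1, 0], (conv_ne_zero_iff _).mpr (by right; right; simp), by simp [Fin.sum_univ_three]⟩

/-- The tangent cone of `conv` is `u₁²u₂`. [folklore] -/
lemma cone_conv : cone 3 conv = (MvPolynomial.X 0 ^ 2 * MvPolynomial.X 1 : MvPolynomial (Fin 3) (ZMod 3)) := by
  unfold cone
  rw [Finset.sum_eq_single (![2, 1, 0] : Fin 3 → ℕ)]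
  · rw [if_pos (by simp [Fin.sum_univ_three]), clean_conv]
    have hc : conv ![2, 1, 0] = 1 := by
      unfold conv; simp
    have hE : Finsupp.equivFunOnFinite.symm (![2, 1, 0] : Fin 3 → ℕ) =
        Finsupp.single 0 2 + Finsupp.single 1 1 := by
      ext j; fin_cases j <;> simp
    rw [hc, hE, MvPolynomial.X_pow_eq_monomial, MvPolynomial.X, MvPolynomial.monomial_mul, one_mul]
  · intro B _ hne
    by_cases hs : Finset.sum Finset.univ (fun j => B j) = 3
    · rw [if_pos hs, clean_conv]
      have hB : conv B = 0 := by
        by_contra hcon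
        rw [Fin.sum_univ_three] at hs
        rcases (conv_ne_zero_iff B).mp hcon with h | h | h
        · omega
        · omega
        · exact hne (funext fun j => by fin_cases j <;> simp [h.1, h.2.1, h.2.2])
      rw [hB, map_zero]
    · rw [if_neg hs]
  · intro h
    exact absurd (Fintype.mem_piFinset.mpr fun j => by fin_cases j <;> simp) h

/-- The cone-invariance space of `conv` is EXACTLY the line `⟨e₃⟩`: `w ∈ L(u₁²u₂) ↔ w₁ = w₂ = 0`
(evaluate the defining identity at two points). [folklore] -/
lemma mem_Linv_conv_iff (v : Fin 3 → ZMod 3) : v ∈ Linv 3 conv ↔ v 0 = 0 ∧ v 1 = 0 := by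
  unfold Linv
  rw [Set.mem_setOf_eq, cone_conv]
  constructor
  · intro hv
    simp only [map_mul, map_pow, MvPolynomial.aeval_X, MvPolynomial.rename_X, MvPolynomial.eval_X] at hv
    -- evaluate at (x₀, x₁, x₂, S) = (1, 0, 0, 1) and (0, 1, 0, 1)
    let g₁ : Option (Fin 3) → ZMod 3 := fun o => o.elim 1 (Pi.single 0 1)
    let g₂ : Option (Fin 3) → ZMod 3 := fun o => o.elim 1 (Pi.single 1 1)
    have h₁ := congrArg (MvPolynomial.eval g₁) hv
    have h₂ := congrArg (MvPolynomial.eval g₂) hv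
    simp only [map_mul, map_pow, map_add, MvPolynomial.eval_X, MvPolynomial.eval_C, g₁, g₂,
      Option.elim_none, Option.elim_some, Pi.single_eq_same,
      Pi.single_eq_of_ne (show (1 : Fin 3) ≠ 0 by decide),
      Pi.single_eq_of_ne (show (0 : Fin 3) ≠ 1 by decide)] at h₁ h₂
    have hv0 : v 0 ^ 2 = 0 := by linear_combination h₂
    have hv0' : v 0 = 0 := pow_eq_zero_iff (two_ne_zero) |>.mp hv0
    refine ⟨hv0', ?_⟩
    rw [hv0'] at h₁
    linear_combination h₁
  · rintro ⟨h0, h1⟩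
    simp [h0, h1]

/-- Hence `dL conv = 1`. [folklore] -/
lemma dL_conv : dL 3 conv = 1 := by
  have hset : Linv 3 conv = (Submodule.span (ZMod 3) {(Pi.single 2 1 : Fin 3 → ZMod 3)} : Set _) := by
    ext v
    rw [mem_Linv_conv_iff, SetLike.mem_coe, Submodule.mem_span_singleton]
    constructor
    · rintro ⟨h0, h1⟩
      refine ⟨v 2, ?_⟩
      funext j
      fin_cases j <;> simp [h0, h1]
    · rintro ⟨a, rfl⟩
      simp
  unfold dL
  rw [hset, Submodule.span_eq, finrank_span_singleton]
  simp

/-- **`conv` is ISOLATED**: `∂a = (2u₁u₂, u₁² + 2u₂⁴, u₃⁶)`, so `u₁³, u₂⁵, u₃⁶ ∈ (∂a)`. [folklore] -/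
lemma isol_conv : Module.Finite (ZMod 3) (MvPowerSeries (Fin 3) (ZMod 3) ⧸ jac 3 conv) := by
  have hJ : ∀ k : Fin 3, pd k (ser 3 conv) ∈ jac 3 conv := fun k => Ideal.subset_span ⟨k, rfl⟩
  have h0 : monomial (Finsupp.single (0 : Fin 3) 1 + Finsupp.single (1 : Fin 3) 1) (2 : ZMod 3) ∈
      jac 3 conv := pd0_conv ▸ hJ 0
  have h1 : monomial (Finsupp.single (1 : Fin 3) 4) (2 : ZMod 3) +
      monomial (Finsupp.single (0 : Fin 3) 2) (1 : ZMod 3) ∈ jac 3 conv := pd1_conv ▸ hJ 1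
  have h2 : monomial (Finsupp.single (2 : Fin 3) 6) (1 : ZMod 3) ∈ jac 3 conv := pd2_conv ▸ hJ 2
  -- rewrite the generators as X-expressions
  have hm01 : (X 0 : MvPowerSeries (Fin 3) (ZMod 3)) * X 1 =
      monomial (Finsupp.single (0 : Fin 3) 1 + Finsupp.single (1 : Fin 3) 1) 1 := by
    rw [show (X 0 : MvPowerSeries (Fin 3) (ZMod 3)) = X 0 ^ 1 from (pow_one _).symm,
      show (X 1 : MvPowerSeries (Fin 3) (ZMod 3)) = X 1 ^ 1 from (pow_one _).symm,
      X_pow_eq, X_pow_eq, monomial_mul_monomial, one_mul]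
  have e0 : monomial (Finsupp.single (0 : Fin 3) 1 + Finsupp.single (1 : Fin 3) 1) (2 : ZMod 3) =
      (2 : MvPowerSeries (Fin 3) (ZMod 3)) * (X 0 * X 1) := by
    rw [hm01, two_mul, ← map_add]; rfl
  have e1 : monomial (Finsupp.single (1 : Fin 3) 4) (2 : ZMod 3) +
      monomial (Finsupp.single (0 : Fin 3) 2) (1 : ZMod 3) =
      (2 : MvPowerSeries (Fin 3) (ZMod 3)) * X 1 ^ 4 + X 0 ^ 2 := by
    rw [X_pow_eq, X_pow_eq, two_mul, ← map_add]; rfl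
  have e2 : monomial (Finsupp.single (2 : Fin 3) 6) (1 : ZMod 3) =
      (X 2 : MvPowerSeries (Fin 3) (ZMod 3)) ^ 6 := (X_pow_eq _ _).symm
  rw [e0] at h0
  rw [e1] at h1
  rw [e2] at h2
  -- characteristic 3 inside the power series ring
  have h3 : (3 : MvPowerSeries (Fin 3) (ZMod 3)) = 0 := by
    rw [show (3 : MvPowerSeries (Fin 3) (ZMod 3)) = algebraMap (ZMod 3) _ 3 from (map_ofNat _ 3).symm,
      show (3 : ZMod 3) = 0 from rfl, map_zero]
  -- u₁u₂ ∈ J :  u₁u₂ = 2·(2u₁u₂) − 3u₁u₂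
  have h01 : (X 0 : MvPowerSeries (Fin 3) (ZMod 3)) * X 1 ∈ jac 3 conv := by
    rw [show (X 0 : MvPowerSeries (Fin 3) (ZMod 3)) * X 1 =
      2 * (2 * (X 0 * X 1)) - 3 * (X 0 * X 1) from by ring, h3, zero_mul, sub_zero]
    exact Ideal.mul_mem_left _ _ h0
  -- u₁³ = u₁ (2u₂⁴ + u₁²) − 2u₂³ (u₁u₂)
  have hX0 : (X 0 : MvPowerSeries (Fin 3) (ZMod 3)) ^ 3 ∈ jac 3 conv := by
    rw [show (X 0 : MvPowerSeries (Fin 3) (ZMod 3)) ^ 3 =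
      X 0 * (2 * X 1 ^ 4 + X 0 ^ 2) - 2 * X 1 ^ 3 * (X 0 * X 1) from by ring]
    exact Ideal.sub_mem _ (Ideal.mul_mem_left _ _ h1) (Ideal.mul_mem_left _ _ h01)
  -- u₂⁵ = 2·(u₂ (2u₂⁴ + u₁²) − u₁ (u₁u₂)) − 3u₂⁵
  have hX1 : (X 1 : MvPowerSeries (Fin 3) (ZMod 3)) ^ 5 ∈ jac 3 conv := by
    rw [show (X 1 : MvPowerSeries (Fin 3) (ZMod 3)) ^ 5 =
      2 * (X 1 * (2 * X 1 ^ 4 + X 0 ^ 2) - X 0 * (X 0 * X 1)) - 3 * X 1 ^ 5 from by ring,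
      h3, zero_mul, sub_zero]
    exact Ideal.mul_mem_left _ _
      (Ideal.sub_mem _ (Ideal.mul_mem_left _ _ h1) (Ideal.mul_mem_left _ _ h01))
  apply module_finite_quotient_of_X_pow_mem _ 6
  intro k
  fin_cases k
  · show (X 0 : MvPowerSeries (Fin 3) (ZMod 3)) ^ 6 ∈ jac 3 conv
    rw [show (X 0 : MvPowerSeries (Fin 3) (ZMod 3)) ^ 6 = X 0 ^ 3 * X 0 ^ 3 from by ring]
    exact Ideal.mul_mem_left _ _ hX0
  · show (X 1 : MvPowerSeries (Fin 3) (ZMod 3)) ^ 6 ∈ jac 3 conv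
    rw [show (X 1 : MvPowerSeries (Fin 3) (ZMod 3)) ^ 6 = X 1 * X 1 ^ 5 from by ring]
    exact Ideal.mul_mem_left _ _ hX1
  · exact h2

end Summit.ResolutionOfSingularities.ResolutionOfSingularities.Theorems.ConeExit.Negative

end
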